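import Literature.NumberTheory.Automorphic.CuspidalMautnerGL2
import HarnessLib

/-!
# Iwahori refactorisation in `SL₂`: moving a lower unipotent past an upper one

Elementary `2 × 2` identities used to compute Whittaker coefficients of unipotent averages of smooth
vectors at the points `ι_v(m) h`, `m ∈ K(M)` (the `L²`-bound of Kirillov functions at a finite place,
Rankin–Selberg theory at `s = 1` for `GL₂`): for `1 + c x ≠ 0`,

  `n̄(c) n(x) = n(x / (1 + c x)) · diag((1 + c x)⁻¹, 1 + c x) · n̄(c / (1 + c x))`
  (`SL2Mautner.lower_mul_upper`),

`diag(t, t⁻¹) n(x) diag(t, t⁻¹)⁻¹ = n(t² x)` (`SL2Mautner.torus_mul_upper_mul_torus_inv`) and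
`n̄(x) d(t) = d(t) n̄(t x)` (`SL2Mautner.lower_mul_diagOne`). [folklore]
-/

open scoped MatrixGroups

namespace Literature.NumberTheory.Automorphic

namespace SL2Mautner

variable {F : Type*} [Field F]

/-- **Iwahori refactorisation**: `n̄(c) n(x) = n(x/(1+cx)) · diag((1+cx)⁻¹, 1+cx) · n̄(c/(1+cx))`
for `1 + c x ≠ 0`. [folklore] -/
theorem lower_mul_upper (c x : F) (h : 1 + c * x ≠ 0) :
    lower c * upper x =
      upper (x / (1 + c * x)) * (torus (Units.mk0 (1 + c * x) h))⁻¹ * lower (c / (1 + c * x)) := by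
  refine Subtype.ext ?_
  rw [Matrix.SpecialLinearGroup.coe_mul, Matrix.SpecialLinearGroup.coe_mul,
    Matrix.SpecialLinearGroup.coe_mul, ← map_inv, coe_lower, coe_upper, coe_upper, coe_lower, coe_torus]
  simp only [Units.val_inv_eq_inv_val, Units.val_mk0, inv_inv]
  have h' : 1 + x * c ≠ 0 := by rwa [mul_comm x c]
  ext i j
  fin_cases i <;> fin_cases j
  · simp [Matrix.mul_apply, Fin.sum_univ_two]
    field_simp
  · simp [Matrix.mul_apply, Fin.sum_univ_two]
    field_simp
  · simp [Matrix.mul_apply, Fin.sum_univ_two]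
    field_simp
  · simp [Matrix.mul_apply, Fin.sum_univ_two]
    ring

/-- `diag(t, t⁻¹) n(x) diag(t, t⁻¹)⁻¹ = n(t² x)`. [folklore] -/
theorem torus_mul_upper_mul_torus_inv (t : Fˣ) (x : F) :
    torus t * upper x * (torus t)⁻¹ = upper ((t : F) ^ 2 * x) := by
  refine Subtype.ext ?_
  rw [Matrix.SpecialLinearGroup.coe_mul, Matrix.SpecialLinearGroup.coe_mul, ← map_inv, coe_torus,
    coe_upper, coe_torus, coe_upper]
  simp only [inv_inv, Units.val_inv_eq_inv_val]
  ext i j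
  fin_cases i <;> fin_cases j
  · simp [Matrix.mul_apply, Fin.sum_univ_two]
  · simp [Matrix.mul_apply, Fin.sum_univ_two]; ring
  · simp [Matrix.mul_apply, Fin.sum_univ_two]
  · simp [Matrix.mul_apply, Fin.sum_univ_two]

/-- `n̄(x) d(t) = d(t) n̄(t x)` in `GL₂` (from `diagOne_inv_mul_lower_mul_diagOne`). [folklore] -/
theorem lower_mul_diagOne (t : Fˣ) (x : F) :
    Matrix.SpecialLinearGroup.toGL (lower x) * diagOne t =
      diagOne t * Matrix.SpecialLinearGroup.toGL (lower ((t : F) * x)) := by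
  rw [← diagOne_inv_mul_lower_mul_diagOne t x, ← mul_assoc, ← mul_assoc, mul_inv_cancel, one_mul]

/-- `d(s t) = d(s) d(t)`. [folklore] -/
theorem diagOne_mul (s t : Fˣ) : diagOne (s * t) = diagOne s * diagOne t := by
  refine Units.ext ?_
  rw [Units.val_mul, coe_diagOne, coe_diagOne, coe_diagOne]
  ext i j
  fin_cases i <;> fin_cases j <;> simp [Matrix.mul_apply, Fin.sum_univ_two]

/-- `d(t ^ k) = d(t) ^ k`. [folklore] -/
theorem diagOne_pow (t : Fˣ) (k : ℕ) : diagOne (t ^ k) = diagOne t ^ k := by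
  induction k with
  | zero =>
    refine Units.ext ?_
    rw [pow_zero, pow_zero, coe_diagOne, Units.val_one]
    ext i j
    fin_cases i <;> fin_cases j <;> simp
  | succ k ih => rw [pow_succ, diagOne_mul, ih, pow_succ]

end SL2Mautner

end Literature.NumberTheory.Automorphic
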